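import Literature.Analysis.SpecialFunctions.RiemannThetaCharacteristics
import HarnessLib

/-!
# The gradient of the Riemann theta function with characteristics as the series of termwise
# derivatives (Lange 2023, Prop. 3.3.6: termwise differentiation)

Topic `Literature/Analysis/SpecialFunctions`; namespace `Literature.Analysis.SpecialFunctions`.
Everything here is PROVED (theorems only; no definition, no named fact).

The tree's `differentiable_riemannTheta` / `differentiable_riemannThetaChar`
(`RiemannTheta.lean`, `RiemannThetaCharacteristics.lean`; Lange–Birkenhake Prop. 3.3.6 "the series
converges absolutely and uniformly on every compact set", whence holomorphy by termwise
differentiation) record differentiability only.  Here the DERIVATIVE is recorded as the series of the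
termwise derivatives, which is what the weighted (weight-two) binary theta series of
`NumberTheory/ModularForms/BinaryThetaWeighted.lean` are:

* `hasFDerivAt_riemannThetaCharTerm` — `d_z e(πi ᵗ(m+a)Ω(m+a) + 2πi ᵗ(m+a)(z+b)) = (term) · 2πi ᵗ(m+a) dz`;
* **`hasFDerivAt_riemannThetaChar`** — for symmetric `Ω` with `Im Ω ≥ c > 0`:
  `HasFDerivAt ϑ[a;b](·, Ω) (Σ_m term_m(z) · 2πi Σᵢ (mᵢ + aᵢ) dzᵢ) z` (Mathlib's
  `hasFDerivAt_tsum_of_isPreconnected` on the unit ball about `z`, dominated by the Gaussian majorant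
  of the tree's `norm_riemannThetaTerm_le` after absorbing the linear factor `Σ|mᵢ + aᵢ|` by
  completing the square, `neg_mul_sq_add_mul_abs_le`);
* `hasSum_fderiv_riemannThetaChar_apply` — applied to a vector `ℓ`:
  `∇_z ϑ[a;b](z, Ω) ℓ = Σ_m 2πi ᵗ(m+a)ℓ · term_m(z)` as a `HasSum`.

## References

* [LangeBirkenhake1992] H. Lange, Ch. Birkenhake, *Complex Abelian Varieties*, §3.3.2 Prop. 3.3.6.
* [MumfordTata1] D. Mumford, *Tata Lectures on Theta I*, Ch. II §1.
-/

noncomputable section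

open _root_.Complex Real Finset Filter Topology Matrix

namespace Literature.Analysis.SpecialFunctions

variable {g : ℕ}

/-- The derivative in `z` of the general term with characteristic:
`d_z e(πi ᵗ(m+a)Ω(m+a) + 2πi ᵗ(m+a)(z+b)) = term · 2πi Σᵢ (mᵢ + aᵢ) dzᵢ`.
[cite: LangeBirkenhake1992, §3.3.2 Prop. 3.3.6] -/
theorem hasFDerivAt_riemannThetaCharTerm (a b : Fin g → ℂ) (Ω : Matrix (Fin g) (Fin g) ℂ)
    (m : Fin g → ℤ) (z : Fin g → ℂ) :
    HasFDerivAt (fun w => riemannThetaCharTerm a b Ω w m)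
      (riemannThetaCharTerm a b Ω z m •
        ((2 * π * I) • ∑ i, ((m i : ℂ) + a i) • ContinuousLinearMap.proj (R := ℂ) (φ := fun _ : Fin g => ℂ) i))
      z := by
  have h1 : HasFDerivAt (fun w : Fin g → ℂ => ((fun i => (m i : ℂ)) + a) ⬝ᵥ (w + b))
      (∑ i, ((m i : ℂ) + a i) • ContinuousLinearMap.proj (R := ℂ) (φ := fun _ : Fin g => ℂ) i) z := by
    have := HasFDerivAt.fun_sum (u := Finset.univ)
      (A := fun i (w : Fin g → ℂ) => ((m i : ℂ) + a i) * (w i + b i))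
      (A' := fun i => ((m i : ℂ) + a i) • ContinuousLinearMap.proj (R := ℂ) (φ := fun _ : Fin g => ℂ) i)
      (x := z) fun i _ =>
        (((ContinuousLinearMap.proj (R := ℂ) (φ := fun _ : Fin g => ℂ) i).hasFDerivAt.add_const
          (b i)).const_mul ((m i : ℂ) + a i))
    simp only [dotProduct, Pi.add_apply]
    exact this
  have hL : HasFDerivAt (fun w : Fin g → ℂ =>
      π * I * ((((fun i => (m i : ℂ)) + a) ⬝ᵥ (Ω *ᵥ ((fun i => (m i : ℂ)) + a)))) +
        2 * π * I * (((fun i => (m i : ℂ)) + a) ⬝ᵥ (w + b)))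
      ((2 * π * I) • ∑ i, ((m i : ℂ) + a i) • ContinuousLinearMap.proj (R := ℂ) (φ := fun _ : Fin g => ℂ) i)
      z := (h1.const_mul (2 * π * I)).const_add _
  exact hL.cexp

/-- Norm of the termwise derivative: at most `2π Σᵢ |mᵢ + aᵢ|` times the norm of the term.
[cite: LangeBirkenhake1992, §3.3.2 Prop. 3.3.6] -/
theorem norm_fderiv_riemannThetaCharTerm_le (a b : Fin g → ℂ) (Ω : Matrix (Fin g) (Fin g) ℂ)
    (m : Fin g → ℤ) (z : Fin g → ℂ) :
    ‖riemannThetaCharTerm a b Ω z m •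
        ((2 * π * I) • ∑ i, ((m i : ℂ) + a i) • ContinuousLinearMap.proj (R := ℂ) (φ := fun _ : Fin g => ℂ) i)‖ ≤
      ‖riemannThetaCharTerm a b Ω z m‖ * (2 * π * ∑ i, ‖(m i : ℂ) + a i‖) := by
  rw [norm_smul]
  refine mul_le_mul_of_nonneg_left ?_ (norm_nonneg _)
  rw [norm_smul, Finset.mul_sum]
  have h2 : ‖(2 * π * I : ℂ)‖ = 2 * π := by
    rw [norm_mul, norm_mul, Complex.norm_I, mul_one, Complex.norm_ofNat, Complex.norm_real,
      Real.norm_of_nonneg pi_pos.le]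
  rw [h2]
  refine (mul_le_mul_of_nonneg_left (norm_sum_le _ _) (by positivity)).trans ?_
  rw [Finset.mul_sum]
  refine Finset.sum_le_sum fun i _ => mul_le_mul_of_nonneg_left ?_ (by positivity)
  rw [norm_smul]
  calc ‖(m i : ℂ) + a i‖ * ‖ContinuousLinearMap.proj (R := ℂ) (φ := fun _ : Fin g => ℂ) i‖
      ≤ ‖(m i : ℂ) + a i‖ * 1 :=
        mul_le_mul_of_nonneg_left (ContinuousLinearMap.opNorm_le_bound _ zero_le_one fun x => by
          rw [one_mul]; exact norm_le_pi_norm x i) (norm_nonneg _)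
    _ = ‖(m i : ℂ) + a i‖ := mul_one _

/-- `Σᵢ |mᵢ + aᵢ| ≤ (1 + Σᵢ |aᵢ|) · exp(Σᵢ |mᵢ|)`. [folklore] -/
private theorem sum_norm_add_le_mul_exp (a : Fin g → ℂ) (m : Fin g → ℤ) :
    ∑ i, ‖(m i : ℂ) + a i‖ ≤ (1 + ∑ i, ‖a i‖) * rexp (∑ i, |(m i : ℝ)|) := by
  have h1 : ∑ i, ‖(m i : ℂ) + a i‖ ≤ ∑ i, |(m i : ℝ)| + ∑ i, ‖a i‖ := by
    rw [← Finset.sum_add_distrib]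
    refine Finset.sum_le_sum fun i _ => (norm_add_le _ _).trans ?_
    rw [← Complex.ofReal_intCast, Complex.norm_real, Real.norm_eq_abs]
  have h2 : ∑ i, |(m i : ℝ)| ≤ rexp (∑ i, |(m i : ℝ)|) := (Real.add_one_le_exp _).trans' (by linarith)
  have h3 : (1 : ℝ) ≤ rexp (∑ i, |(m i : ℝ)|) :=
    Real.one_le_exp (Finset.sum_nonneg fun i _ => abs_nonneg _)
  have h4 : 0 ≤ ∑ i, ‖a i‖ := Finset.sum_nonneg fun i _ => norm_nonneg _
  nlinarith

/-- The summable Gaussian majorant of the termwise derivatives on the unit ball about `z₀`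
(symmetric `Ω`, `Im Ω ≥ c > 0`). [cite: LangeBirkenhake1992, §3.3.2 Prop. 3.3.6] -/
private theorem exists_majorant_fderiv_riemannThetaCharTerm (Ω : Matrix (Fin g) (Fin g) ℂ)
    (hΩ : ∀ i j, Ω i j = Ω j i) {c : ℝ} (hc : 0 < c)
    (hY : ∀ x : Fin g → ℝ, c * ∑ i, x i ^ 2 ≤ ∑ i, ∑ j, x i * (Ω i j).im * x j)
    (a b z₀ : Fin g → ℂ) :
    ∃ u : (Fin g → ℤ) → ℝ, Summable u ∧ ∀ (m : Fin g → ℤ) (z : Fin g → ℂ), z ∈ Metric.ball z₀ 1 →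
      ‖riemannThetaCharTerm a b Ω z m • ((2 * π * I) •
        ∑ i, ((m i : ℂ) + a i) • ContinuousLinearMap.proj (R := ℂ) (φ := fun _ : Fin g => ℂ) i)‖ ≤ u m := by
  -- the prefactor `E(z) = e(πi ᵗaΩa + 2πi ᵗa(z+b))` is bounded on the ball
  obtain ⟨E, hE⟩ : ∃ E : (Fin g → ℂ) → ℂ,
      E = fun z => cexp (π * I * (a ⬝ᵥ (Ω *ᵥ a)) + 2 * π * I * (a ⬝ᵥ (z + b))) := ⟨_, rfl⟩
  have hEc : Continuous E := by
    rw [hE]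
    refine Complex.continuous_exp.comp (continuous_const.add (continuous_const.mul ?_))
    simp only [dotProduct]
    exact continuous_finsetSum _ fun i _ => continuous_const.mul ((continuous_apply i).add continuous_const)
  obtain ⟨Emax, hEmax⟩ : ∃ Emax : ℝ, ∀ z ∈ Metric.closedBall z₀ 1, ‖E z‖ ≤ Emax := by
    have hK : IsCompact (Metric.closedBall z₀ (1 : ℝ)) := isCompact_closedBall z₀ 1
    obtain ⟨C, hC⟩ := hK.exists_bound_of_continuousOn (hEc.norm.continuousOn)
    exact ⟨C, fun z hz => by have := hC z hz; rwa [Real.norm_of_nonneg (norm_nonneg _)] at this⟩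
  have hEmax0 : 0 ≤ Emax := (norm_nonneg _).trans (hEmax z₀ (Metric.mem_closedBall_self zero_le_one))
  -- the shifted argument `z + Ωa + b` has bounded imaginary parts on the ball
  obtain ⟨R, hR⟩ : ∃ R : ℝ, R = ‖z₀‖ + 1 + ‖Ω *ᵥ a + b‖ := ⟨_, rfl⟩
  have hball : ∀ z ∈ Metric.ball z₀ 1, ∀ i, |((z + Ω *ᵥ a + b) i).im| ≤ R := by
    intro z hz i
    have h1 : ‖z‖ ≤ ‖z₀‖ + 1 := by
      have := norm_le_norm_add_norm_sub' z z₀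
      have h2 : ‖z - z₀‖ < 1 := by rwa [← dist_eq_norm]
      linarith
    have h3 : ‖z + Ω *ᵥ a + b‖ ≤ R := by
      rw [add_assoc]
      exact (norm_add_le _ _).trans (by rw [hR]; linarith)
    exact ((Complex.abs_im_le_norm _).trans (norm_le_pi_norm _ i)).trans h3
  -- the majorant
  obtain ⟨A, hA⟩ : ∃ A : ℝ, A = 1 + ∑ i, ‖a i‖ := ⟨_, rfl⟩
  have hA0 : 0 ≤ A := by rw [hA]; positivity
  obtain ⟨u, hu⟩ : ∃ u : (Fin g → ℤ) → ℝ, u = fun m => Emax * (rexp (g * ((2 * π * R) ^ 2 / (2 * (π * c)))) *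
    (2 * π * A * (rexp (g * (1 / (π * c))) * ∏ i, rexp (-(π * c / 4 * (m i : ℝ) ^ 2))))) := ⟨_, rfl⟩
  have hu_sum : Summable u := by
    rw [hu]
    exact ((((summable_prod_exp_neg_mul_sq (by positivity)).mul_left _).mul_left _).mul_left _).mul_left _
  refine ⟨u, hu_sum, fun m z hz => ?_⟩
  refine (norm_fderiv_riemannThetaCharTerm_le a b Ω m z).trans ?_
  rw [riemannThetaCharTerm_eq_cexp_mul Ω hΩ a b z m, norm_mul]
  have hEz : ‖cexp (π * I * (a ⬝ᵥ (Ω *ᵥ a)) + 2 * π * I * (a ⬝ᵥ (z + b)))‖ ≤ Emax := by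
    have := hEmax z (Metric.ball_subset_closedBall hz)
    rwa [hE] at this
  have hT := norm_riemannThetaTerm_le Ω hc hY (z + Ω *ᵥ a + b) (hball z hz) m
  have hS : ∑ i, ‖(m i : ℂ) + a i‖ ≤ A * rexp (∑ i, |(m i : ℝ)|) := by
    rw [hA]; exact sum_norm_add_le_mul_exp a m
  -- `exp(Σ|mᵢ|) ∏ exp(-(πc/2) mᵢ²) ≤ exp(g/(πc)) ∏ exp(-(πc/4) mᵢ²)`
  have hsq : rexp (∑ i, |(m i : ℝ)|) * ∏ i, rexp (-(π * c / 2 * (m i : ℝ) ^ 2)) ≤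
      rexp (g * (1 / (π * c))) * ∏ i, rexp (-(π * c / 4 * (m i : ℝ) ^ 2)) := by
    rw [← Real.exp_sum, ← Real.exp_add, ← Real.exp_sum, ← Real.exp_add]
    refine Real.exp_le_exp.mpr ?_
    have h5 : ∀ i, -(π * c / 2 * (m i : ℝ) ^ 2) + 1 * |(m i : ℝ)| ≤
        -(π * c / 2 / 2 * (m i : ℝ) ^ 2) + 1 ^ 2 / (2 * (π * c / 2)) := fun i =>
      neg_mul_sq_add_mul_abs_le (by positivity) 1 (m i : ℝ)
    have h6 : ∑ i, (|(m i : ℝ)| + -(π * c / 2 * (m i : ℝ) ^ 2)) ≤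
        ∑ i, (1 / (π * c) + -(π * c / 4 * (m i : ℝ) ^ 2)) :=
      Finset.sum_le_sum fun i _ => by
        have := h5 i
        have e1 : π * c / 2 / 2 = π * c / 4 := by ring
        have e2 : (1 : ℝ) ^ 2 / (2 * (π * c / 2)) = 1 / (π * c) := by field_simp
        rw [e1, e2] at this
        linarith
    rw [← Finset.sum_add_distrib]
    calc ∑ i, (|(m i : ℝ)| + -(π * c / 2 * (m i : ℝ) ^ 2))
        ≤ ∑ i, (1 / (π * c) + -(π * c / 4 * (m i : ℝ) ^ 2)) := h6
      _ = g * (1 / (π * c)) + ∑ i, -(π * c / 4 * (m i : ℝ) ^ 2) := by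
          rw [Finset.sum_add_distrib, Finset.sum_const, Finset.card_univ, Fintype.card_fin,
            nsmul_eq_mul]
  have hGauss : 0 ≤ rexp (g * ((2 * π * R) ^ 2 / (2 * (π * c)))) := (Real.exp_pos _).le
  calc ‖cexp (π * I * (a ⬝ᵥ (Ω *ᵥ a)) + 2 * π * I * (a ⬝ᵥ (z + b)))‖ *
        ‖riemannThetaTerm Ω (z + Ω *ᵥ a + b) m‖ * (2 * π * ∑ i, ‖(m i : ℂ) + a i‖)
      ≤ Emax * (rexp (g * ((2 * π * R) ^ 2 / (2 * (π * c)))) * ∏ i, rexp (-(π * c / 2 * (m i : ℝ) ^ 2)))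
          * (2 * π * (A * rexp (∑ i, |(m i : ℝ)|))) := by
        gcongr
    _ = Emax * (rexp (g * ((2 * π * R) ^ 2 / (2 * (π * c)))) * (2 * π * A *
          (rexp (∑ i, |(m i : ℝ)|) * ∏ i, rexp (-(π * c / 2 * (m i : ℝ) ^ 2))))) := by ring
    _ ≤ Emax * (rexp (g * ((2 * π * R) ^ 2 / (2 * (π * c)))) * (2 * π * A *
          (rexp (g * (1 / (π * c))) * ∏ i, rexp (-(π * c / 4 * (m i : ℝ) ^ 2))))) :=
        mul_le_mul_of_nonneg_left (mul_le_mul_of_nonneg_left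
          (mul_le_mul_of_nonneg_left hsq (by positivity)) hGauss) hEmax0
    _ = u m := by rw [hu]

/-- **The gradient of `ϑ[a; b](·, Ω)` is the series of termwise derivatives** (symmetric `Ω` with
`Im Ω ≥ c > 0`): the series `Σ_m term_m(z) · 2πi Σᵢ (mᵢ + aᵢ) dzᵢ` of continuous linear maps
converges (`HasSum`) to a derivative of `ϑ[a;b](·, Ω)` at `z` — termwise differentiation on the
unit ball about `z`, the series of derivatives being dominated by a summable Gaussian majorant
(Lange Prop. 3.3.6). [cite: LangeBirkenhake1992, §3.3.2 Prop. 3.3.6] -/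
theorem hasFDerivAt_riemannThetaChar (Ω : Matrix (Fin g) (Fin g) ℂ) (hΩ : ∀ i j, Ω i j = Ω j i)
    {c : ℝ} (hc : 0 < c)
    (hY : ∀ x : Fin g → ℝ, c * ∑ i, x i ^ 2 ≤ ∑ i, ∑ j, x i * (Ω i j).im * x j)
    (a b z₀ : Fin g → ℂ) :
    HasFDerivAt (riemannThetaChar a b Ω)
      (∑' m : Fin g → ℤ, riemannThetaCharTerm a b Ω z₀ m •
        ((2 * π * I) • ∑ i, ((m i : ℂ) + a i) • ContinuousLinearMap.proj (R := ℂ) (φ := fun _ : Fin g => ℂ) i))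
      z₀ ∧
    Summable (fun m : Fin g → ℤ => riemannThetaCharTerm a b Ω z₀ m •
        ((2 * π * I) • ∑ i, ((m i : ℂ) + a i) • ContinuousLinearMap.proj (R := ℂ) (φ := fun _ : Fin g => ℂ) i)) := by
  obtain ⟨u, hu_sum, hderiv_le⟩ := exists_majorant_fderiv_riemannThetaCharTerm Ω hΩ hc hY a b z₀
  have hz₀ : z₀ ∈ Metric.ball z₀ 1 := Metric.mem_ball_self one_pos
  have hsum₀ : Summable (fun m => riemannThetaCharTerm a b Ω z₀ m) :=
    summable_riemannThetaCharTerm Ω hΩ hc hY a b z₀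
  refine ⟨hasFDerivAt_tsum_of_isPreconnected hu_sum Metric.isOpen_ball
    (convex_ball z₀ 1).isPreconnected (fun m z _ => hasFDerivAt_riemannThetaCharTerm a b Ω m z)
    hderiv_le hz₀ hsum₀ hz₀, ?_⟩
  exact Summable.of_norm_bounded hu_sum fun m => hderiv_le m z₀ hz₀

/-- **The gradient applied to a vector**: `∇_z ϑ[a;b](z, Ω) ℓ = Σ_m 2πi ᵗ(m + a)ℓ · term_m(z)`
(`HasSum`). [cite: LangeBirkenhake1992, §3.3.2 Prop. 3.3.6] -/
theorem hasSum_fderiv_riemannThetaChar_apply (Ω : Matrix (Fin g) (Fin g) ℂ)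
    (hΩ : ∀ i j, Ω i j = Ω j i) {c : ℝ} (hc : 0 < c)
    (hY : ∀ x : Fin g → ℝ, c * ∑ i, x i ^ 2 ≤ ∑ i, ∑ j, x i * (Ω i j).im * x j)
    (a b z ℓ : Fin g → ℂ) :
    HasSum (fun m : Fin g → ℤ =>
        (2 * π * I * ((((fun i => (m i : ℂ)) + a) ⬝ᵥ ℓ))) * riemannThetaCharTerm a b Ω z m)
      (fderiv ℂ (riemannThetaChar a b Ω) z ℓ) := by
  obtain ⟨h, hs⟩ := hasFDerivAt_riemannThetaChar Ω hΩ hc hY a b z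
  rw [h.fderiv]
  have h1 := (hs.hasSum.mapL (ContinuousLinearMap.apply ℂ ℂ ℓ))
  simp only [ContinuousLinearMap.apply_apply, _root_.smul_apply, FunLike.coe_sum, Finset.sum_apply,
    ContinuousLinearMap.proj_apply, smul_eq_mul] at h1
  have heq : (fun m : Fin g → ℤ =>
      (2 * π * I * ((((fun i => (m i : ℂ)) + a) ⬝ᵥ ℓ))) * riemannThetaCharTerm a b Ω z m) =
      fun m => riemannThetaCharTerm a b Ω z m * (2 * π * I * ∑ x, ((m x : ℂ) + a x) * ℓ x) := by
    funext m
    simp only [dotProduct, Pi.add_apply]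
    ring
  rw [heq]
  exact h1

end Literature.Analysis.SpecialFunctions

end
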